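import Literature.Topology.FourManifolds.TrisectionsH23Lid
import Literature.Topology.FourManifolds.TrisectionsHandleCounts
import Literature.Topology.FourManifolds.MorseExtrema
import Literature.Topology.FourManifolds.MorseTurnAbout
import Literature.Topology.FourManifolds.ImmersionOrientation
import HarnessLib

/-!
# The Morse function of the handlebody `H₂₃`, V: the handle decomposition `handleCount 1 g`

Topic `Literature/Topology/FourManifolds`; infrastructure for the fact seat
`provefact-Literature.Topology.FourManifolds.exists_isBalancedGKTrisection` (Gay–Kirby 2016,
Thm. 4 via §4, Lemma 14), concluding the series `TrisectionsH23Function/Regular/Critical/Lid`.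
Everything in this file is **proved**; no named facts are introduced.

* `TubeFrame.axisPt`, `TubeFrame.isMCriticalPt_g_iff_eq_axisPt`, `TubeFrame.morseIndex_g_axisPt`
  — **the critical points of the Heegaard function `g` on the thin tube of the `j`-th attaching
  circle are the four axis points**, two of index `0` and two of index `1`
  (`HeegaardGerm.nondegenerate_and_morseIndex_eq_zero/one`);
* `BeltParams.ncard_crit_g_eq` — hence `c_i(g) = #critY_i + 2m` (`i = 0, 1`), `c_i(g)` the
  number of critical points of `g` of index `i` below `b`, `m` the number of `2`-handles;
* `BeltParams.isMorseAdapted_FH` — `F_H` is a Morse function adapted to the boundary of `H₂₃`;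
  `BeltParams.ncard_criticalSetOfIndex_FH` — its critical points of index `i` number
  `#critY_i + m` for `i = 0, 1` and `0` for `i ≥ 2` (lid points and belt points);
* `BeltParams.connectedSpace_H₂₃` — `H₂₃` is connected when the central surface is (a
  component missing the boundary would carry an interior maximum of `F_H`, of index `3`);
* `BeltParams.hasHandleDecomposition_H₂₃` — **`H₂₃` has a handle decomposition with one
  `0`-handle and `gen` `1`-handles**, `gen + c₀(g) = c₁(g) + 1` (Milnor 1965, Thm. 8.1: the
  surplus `0`-handles cancel): the hypothesis `hH₂₃` of
  `BiCollar.exists_isBalancedGKTrisection_of_handles`, with the genus pinned to that of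
  `H₁₂ = {g ≤ b}` (`RegularSublevel.hasHandleDecomposition_handleCount_one`).

## References

* D. Gay, R. Kirby, *Trisecting 4-manifolds*, Geom. Topol. 20 (2016), §4, Lemma 14. [GayKirby2016]
* J. Milnor, *Lectures on the h-cobordism theorem* (1965), Def. 3.1, Thm. 8.1. [MilnorHCobordism1965]
* J. Milnor, *Morse theory* (1963), §2–§3. [Milnor1963]
-/

open scoped Manifold ContDiff Topology
open Set Function Filter

noncomputable section

universe u

namespace Literature.Topology.FourManifolds

open Flow

variable {X : Type u} [TopologicalSpace X] [T2Space X] [CompactSpace X]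
  [ChartedSpace (EuclideanSpace ℝ (Fin 4)) X] [IsManifold (𝓡 4) ∞ X]

namespace BiCollar

namespace TriData

namespace TubeFrame

variable {B : BiCollar X} {T : B.TriData} {ι : Type} [Fintype ι] (𝔉 : T.TubeFrame ι) {j : ι}

/-! ### The four critical points of `g` on the thin tube of an attaching circle -/

/-- The Milnor coordinates `s √η₂ e_k` of the axis points (`k ∈ {0, 1}`, `s = ±1`). [folklore] -/
def axisVec (k : Fin 4) (s : ℝ) : EuclideanSpace ℝ (Fin 4) := (s * Real.sqrt 𝔉.η₂) • TubeModel.E4 k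

omit [T2Space X] [CompactSpace X] in
/-- Coordinates of `axisVec`. [folklore] -/
@[simp] theorem axisVec_apply (k i : Fin 4) (s : ℝ) :
    𝔉.axisVec k s i = if i = k then s * Real.sqrt 𝔉.η₂ else 0 := by
  simp only [axisVec, PiLp.smul_apply, TubeModel.E4_apply, smul_eq_mul, mul_ite, mul_one, mul_zero]

omit [T2Space X] [CompactSpace X] in
/-- `axisVec k s` lies in the chart target of the box (its norm is `√η₂ < ε_j`), for `k ∈ {0, 1}`, `s = ±1`. [folklore] -/
theorem axisVec_mem_target {k : Fin 4} (hk : k = 0 ∨ k = 1) {s : ℝ} (hs : s = 1 ∨ s = -1) :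
    (𝔉.boxes.box j).chart (𝔉.boxes.cpt j) + 𝔉.axisVec k s ∈ (𝔉.boxes.box j).chart.target := by
  have hs2 : s ^ 2 = 1 := by rcases hs with rfl | rfl <;> norm_num
  have hη := 𝔉.η₂_pos
  have hsq : (s * Real.sqrt 𝔉.η₂) ^ 2 = 𝔉.η₂ := by
    rw [mul_pow, hs2, one_mul, Real.sq_sqrt hη.le]
  have h := (𝔉.boxes.box j).add_mem_target (J := 𝓡 4) (v := 𝔉.axisVec k s) ?_ ?_
  · simpa using h
  · rw [𝔉.boxes.k_eq j, sqSumLT_two_apply]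
    rcases hk with rfl | rfl
    · simp only [axisVec_apply, Fin.isValue, ↓reduceIte, Fin.reduceEq]
      nlinarith [𝔉.boxes.eta_lt j]
    · simp only [axisVec_apply, Fin.isValue, ↓reduceIte, Fin.reduceEq]
      nlinarith [𝔉.boxes.eta_lt j]
  · rw [𝔉.boxes.k_eq j, sqSumGE_two_apply]
    rcases hk with rfl | rfl
    · simp only [axisVec_apply, Fin.isValue, Fin.reduceEq, ↓reduceIte]
      nlinarith [(𝔉.boxes.box j).eps_pos]
    · simp only [axisVec_apply, Fin.isValue, Fin.reduceEq, ↓reduceIte]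
      nlinarith [(𝔉.boxes.box j).eps_pos]

omit [T2Space X] [CompactSpace X] in
/-- `Q₂(axisVec k s) = -η₂` for `k ∈ {0, 1}`, `s = ±1`. [folklore] -/
theorem milnorQuadratic_axisVec {k : Fin 4} (hk : k = 0 ∨ k = 1) {s : ℝ} (hs : s = 1 ∨ s = -1) :
    milnorQuadratic (m := 4) 2 (𝔉.axisVec k s) = -𝔉.η₂ := by
  have hs2 : s ^ 2 = 1 := by rcases hs with rfl | rfl <;> norm_num
  have hsq : (s * Real.sqrt 𝔉.η₂) ^ 2 = 𝔉.η₂ := by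
    rw [mul_pow, hs2, one_mul, Real.sq_sqrt 𝔉.η₂_pos.le]
  rw [TubeModel.milnorQuadratic_two_apply]
  rcases hk with rfl | rfl
  · simp only [axisVec_apply, Fin.isValue, ↓reduceIte, Fin.reduceEq]; nlinarith
  · simp only [axisVec_apply, Fin.isValue, ↓reduceIte, Fin.reduceEq]; nlinarith

/-- **The axis point** `y_j(k, s) = e⁻¹ (e c_j + s √η₂ e_k) ∈ Y` of the `j`-th attaching circle
(`k ∈ {0, 1}`, `s = ±1`). [cite: GayKirby2016, §4, Lemma 14] -/
def axisPt (j : ι) {k : Fin 4} (hk : k = 0 ∨ k = 1) {s : ℝ} (hs : s = 1 ∨ s = -1) : B.Y :=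
  ⟨(𝔉.boxes.box j).chart.symm ((𝔉.boxes.box j).chart (𝔉.boxes.cpt j) + 𝔉.axisVec k s), by
    show B.f _ ∈ ({B.a} : Set ℝ)
    rw [mem_singleton_iff,
      𝔉.f_eq_add_milnorQuadratic j _ ((𝔉.boxes.box j).chart.map_target (𝔉.axisVec_mem_target hk hs)),
      (𝔉.boxes.box j).chart.right_inv (𝔉.axisVec_mem_target hk hs), add_sub_cancel_left,
      𝔉.milnorQuadratic_axisVec hk hs, 𝔉.boxes.apply_cpt j]
    ring⟩

omit [T2Space X] [CompactSpace X] in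
/-- The axis point lies in the chart domain. [folklore] -/
theorem axisPt_mem_source {k : Fin 4} (hk : k = 0 ∨ k = 1) {s : ℝ} (hs : s = 1 ∨ s = -1) :
    (𝔉.axisPt j hk hs).1 ∈ (𝔉.boxes.box j).chart.source :=
  (𝔉.boxes.box j).chart.map_target (𝔉.axisVec_mem_target hk hs)

omit [T2Space X] [CompactSpace X] in
/-- The Milnor coordinates of the axis point. [folklore] -/
theorem chart_axisPt_sub {k : Fin 4} (hk : k = 0 ∨ k = 1) {s : ℝ} (hs : s = 1 ∨ s = -1) :
    (𝔉.boxes.box j).chart (𝔉.axisPt j hk hs).1 - (𝔉.boxes.box j).chart (𝔉.boxes.cpt j) = 𝔉.axisVec k s := by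
  show (𝔉.boxes.box j).chart ((𝔉.boxes.box j).chart.symm _) - _ = _
  rw [(𝔉.boxes.box j).chart.right_inv (𝔉.axisVec_mem_target hk hs), add_sub_cancel_left]

omit [T2Space X] [CompactSpace X] in
/-- **The axis points lie in the thin tube** (`P_j = A_j B_j = η₂ · 0 = 0`). [folklore] -/
theorem axisPt_mem_tubeNbhd {k : Fin 4} (hk : k = 0 ∨ k = 1) {s : ℝ} (hs : s = 1 ∨ s = -1) :
    𝔉.axisPt j hk hs ∈ 𝔉.tubeNbhd j := by
  refine ⟨𝔉.axisPt_mem_source hk hs, ?_⟩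
  have hB : 𝔉.boxes.B j (𝔉.axisPt j hk hs).1 = 0 := by
    rw [𝔉.B_eq_qB, 𝔉.coord_eq_sub (𝔉.axisPt_mem_source hk hs), 𝔉.chart_axisPt_sub hk hs, BeltModel.qB_apply]
    rcases hk with rfl | rfl <;> simp
  rw [HandleBoxes.P_def, hB, mul_zero]
  exact 𝔉.P₀_pos

omit [T2Space X] [CompactSpace X] in
/-- **The critical points of `g` on the thin tube are the four axis points.** [cite: GayKirby2016, §4, Lemma 14] -/
theorem isMCriticalPt_g_iff_eq_axisPt (hεT : 0 < 𝔉.εT) {y : B.Y} (hy : y ∈ 𝔉.tubeNbhd j) :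
    IsMCriticalPt (𝓡 3) B.g y ↔
      ∃ (k : Fin 4) (hk : k = 0 ∨ k = 1) (s : ℝ) (hs : s = 1 ∨ s = -1), y = 𝔉.axisPt j hk hs := by
  rw [𝔉.isMCriticalPt_g_iff_of_mem_tubeNbhd hεT hy]
  set u := (𝔉.boxes.box j).chart y.1 - (𝔉.boxes.box j).chart (𝔉.boxes.cpt j) with hudef
  have hη := 𝔉.η₂_pos
  have hr := Real.sqrt_pos.2 hη
  have hr2 : Real.sqrt 𝔉.η₂ ^ 2 = 𝔉.η₂ := Real.sq_sqrt hη.le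
  -- on the level: `u₀² + u₁² = η₂ + u₂² + u₃²`
  have hlevel : u 0 ^ 2 + u 1 ^ 2 = 𝔉.η₂ + (u 2 ^ 2 + u 3 ^ 2) := by
    have h := 𝔉.A_eq_of_level y hy.1
    rw [𝔉.A_eq_qA, 𝔉.B_eq_qB, 𝔉.coord_eq_sub hy.1, BeltModel.qA_apply, BeltModel.qB_apply] at h
    exact h
  have hrec : y.1 = (𝔉.boxes.box j).chart.symm ((𝔉.boxes.box j).chart (𝔉.boxes.cpt j) + u) := by
    rw [hudef, add_sub_cancel, (𝔉.boxes.box j).chart.left_inv hy.1]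
  constructor
  · rintro ⟨h2, h3, h01⟩
    rw [h2, h3] at hlevel
    simp only [ne_eq, OfNat.ofNat_ne_zero, not_false_eq_true, zero_pow, add_zero] at hlevel
    -- `u₀ u₁ = 0`: two cases
    rcases mul_eq_zero.1 h01 with h0 | h1
    · -- `u₀ = 0`, `u₁ = ±√η₂`
      have hu1 : u 1 ^ 2 = Real.sqrt 𝔉.η₂ ^ 2 := by rw [hr2]; nlinarith [h0]
      have hcases : u 1 = Real.sqrt 𝔉.η₂ ∨ u 1 = -Real.sqrt 𝔉.η₂ := by
        have : (u 1 - Real.sqrt 𝔉.η₂) * (u 1 + Real.sqrt 𝔉.η₂) = 0 := by nlinarith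
        rcases mul_eq_zero.1 this with h | h
        · exact Or.inl (by linarith)
        · exact Or.inr (by linarith)
      rcases hcases with h1 | h1
      · refine ⟨1, Or.inr rfl, 1, Or.inl rfl, Subtype.ext ?_⟩
        have hu : u = 𝔉.axisVec 1 1 := by ext i; fin_cases i <;> simp [h0, h1, h2, h3]
        rw [hrec, hu]; rfl
      · refine ⟨1, Or.inr rfl, -1, Or.inr rfl, Subtype.ext ?_⟩
        have hu : u = 𝔉.axisVec 1 (-1) := by ext i; fin_cases i <;> simp [h0, h1, h2, h3]
        rw [hrec, hu]; rfl
    · -- `u₁ = 0`, `u₀ = ±√η₂`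
      have hu0 : u 0 ^ 2 = Real.sqrt 𝔉.η₂ ^ 2 := by rw [hr2]; nlinarith [h1]
      have hcases : u 0 = Real.sqrt 𝔉.η₂ ∨ u 0 = -Real.sqrt 𝔉.η₂ := by
        have : (u 0 - Real.sqrt 𝔉.η₂) * (u 0 + Real.sqrt 𝔉.η₂) = 0 := by nlinarith
        rcases mul_eq_zero.1 this with h | h
        · exact Or.inl (by linarith)
        · exact Or.inr (by linarith)
      rcases hcases with h0 | h0
      · refine ⟨0, Or.inl rfl, 1, Or.inl rfl, Subtype.ext ?_⟩
        have hu : u = 𝔉.axisVec 0 1 := by ext i; fin_cases i <;> simp [h0, h1, h2, h3]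
        rw [hrec, hu]; rfl
      · refine ⟨0, Or.inl rfl, -1, Or.inr rfl, Subtype.ext ?_⟩
        have hu : u = 𝔉.axisVec 0 (-1) := by ext i; fin_cases i <;> simp [h0, h1, h2, h3]
        rw [hrec, hu]; rfl
  · rintro ⟨k, hk, s, hs, rfl⟩
    rw [hudef, 𝔉.chart_axisPt_sub hk hs]
    rcases hk with rfl | rfl <;> simp

omit [T2Space X] [CompactSpace X] in
/-- **The Morse data of `g` at the axis points**: nondegenerate, of index `0` on the axis `e₀`
(`θ ∈ {0, π}`) and of index `1` on the axis `e₁` (`θ = ±π/2`). [cite: GayKirby2016, §4, Lemma 14] [cite: Milnor1963, §2] -/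
theorem nondegenerate_and_morseIndex_g_axisPt (hεT : 0 < 𝔉.εT) {k : Fin 4} (hk : k = 0 ∨ k = 1) {s : ℝ}
    (hs : s = 1 ∨ s = -1) :
    (mhessian (𝓡 3) B.g (𝔉.axisPt j hk hs)).Nondegenerate ∧
      morseIndex (𝓡 3) B.g (𝔉.axisPt j hk hs) = if k = 0 then 0 else 1 := by
  set y := 𝔉.axisPt j hk hs with hydef
  have hy : y ∈ 𝔉.tubeNbhd j := 𝔉.axisPt_mem_tubeNbhd hk hs
  have he := (𝔉.boxes.box j).mem_maximalAtlas
  have hfe := 𝔉.f_eq_add_milnorQuadratic j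
  have ha : B.a < B.f (𝔉.boxes.cpt j) := by rw [𝔉.boxes.apply_cpt j]; linarith [𝔉.η₂_pos]
  have hκ : 0 < 𝔉.κT / 𝔉.η₂ := div_pos 𝔉.κT_pos 𝔉.η₂_pos
  have hF : 𝔉.Ftube j =ᶠ[𝓝 y.1] fun q => TubeModel.tube 𝔉.εT 𝔉.κT 𝔉.η₂
      ((𝔉.boxes.box j).chart q - (𝔉.boxes.box j).chart (𝔉.boxes.cpt j)) := EventuallyEq.rfl
  have hu := 𝔉.chart_axisPt_sub (j := j) hk hs
  have hr : Real.sqrt 𝔉.η₂ ≠ 0 := (Real.sqrt_pos.2 𝔉.η₂_pos).ne'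
  have hsne : s * Real.sqrt 𝔉.η₂ ≠ 0 := mul_ne_zero (by rcases hs with rfl | rfl <;> norm_num) hr
  -- `g = k_g F|Y + g₀` near `y`
  have hev : B.g =ᶠ[𝓝 y] fun y' => (fun y' => 𝔉.kg * (𝔉.Ftube j ∘ RegularLevel.incl B.hf) y' + 𝔉.g₀) y' + 0 :=
    (𝔉.g_eventuallyEq_of_mem_tubeNbhd hy).trans (Eventually.of_forall fun _ => (add_zero _).symm)
  rw [mhessian_congr_of_eventuallyEq_add_const hev, morseIndex_congr_of_eventuallyEq_add_const hev,
    mhessian_const_mul_add _ 𝔉.kg_pos.ne', morseIndex_const_mul_add _ 𝔉.kg_pos,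
    LinearMap.BilinForm.nondegenerate_smul_iff _ 𝔉.kg_pos.ne']
  rcases hk with rfl | rfl
  · rw [if_pos rfl]
    refine HeegaardGerm.nondegenerate_and_morseIndex_eq_zero he hfe ha hεT hκ y (𝔉.axisPt_mem_source _ hs) hF
      ?_ ?_ ?_ ?_ <;> rw [hu] <;> simp [hsne]
  · rw [if_neg (by decide)]
    refine HeegaardGerm.nondegenerate_and_morseIndex_eq_one he hfe ha hεT hκ y (𝔉.axisPt_mem_source _ hs) hF
      ?_ ?_ ?_ ?_ <;> rw [hu] <;> simp [hsne]

omit [T2Space X] [CompactSpace X] in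
/-- The value of `g` at the axis points is below `b - m₀/2` (`g = k_g 𝒯 + g₀`, `𝒯 ∈ {1 - ε_T, 1}`). [folklore] -/
theorem g_axisPt_le (𝔓 : 𝔉.BeltParams) {k : Fin 4} (hk : k = 0 ∨ k = 1) {s : ℝ} (hs : s = 1 ∨ s = -1) :
    B.g (𝔉.axisPt j hk hs) ≤ B.b - 𝔉.m₀ / 2 := by
  set y := 𝔉.axisPt j hk hs with hydef
  have hy : y ∈ 𝔉.tubeNbhd j := 𝔉.axisPt_mem_tubeNbhd hk hs
  have hu := 𝔉.chart_axisPt_sub (j := j) hk hs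
  have htube : TubeModel.tube 𝔉.εT 𝔉.κT 𝔉.η₂ (𝔉.axisVec k s) ≤ 1 := by
    have h := (TubeModel.tube_sub_mem_Icc 𝔉.εT_nonneg 𝔉.κT 𝔉.η₂ (𝔉.axisVec k s)).2
    have h0 : (𝔉.axisVec k s) 2 ^ 2 + (𝔉.axisVec k s) 3 ^ 2 = 0 := by
      rcases hk with rfl | rfl <;> simp
    rw [h0, mul_zero, sub_zero] at h
    exact h
  rw [𝔉.g_tube j y hy.1 hy.2, 𝔉.coord_eq_sub hy.1, hu]
  have h1 := 𝔓.kg_g₀_le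
  have h2 := 𝔓.small₀
  have hkg := 𝔉.kg_pos
  have hP : 0 ≤ 𝔉.kg * (𝔉.κT / 𝔉.η₂) * 𝔉.P₀ :=
    mul_nonneg (mul_nonneg hkg.le (div_pos 𝔉.κT_pos 𝔉.η₂_pos).le) 𝔉.P₀_pos.le
  have hτ : 0 ≤ 𝔓.τp / 𝔓.β := (div_pos 𝔓.τp_pos 𝔓.β_pos).le
  nlinarith [mul_le_mul_of_nonneg_left htube hkg.le]

/-! ### Counting the critical points of `g` on the thin tubes -/

/-- The sign attached to a Boolean. [folklore] -/
def sgn (b : Bool) : ℝ := if b then 1 else -1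

omit [T2Space X] [CompactSpace X] in
/-- `sgn b = ±1`. [folklore] -/
theorem sgn_cases (b : Bool) : sgn b = 1 ∨ sgn b = -1 := by cases b <;> simp [sgn]

omit [T2Space X] [CompactSpace X] in
/-- A sign is the sign of a Boolean. [folklore] -/
theorem exists_sgn_eq {s : ℝ} (hs : s = 1 ∨ s = -1) : ∃ b, sgn b = s := by
  rcases hs with rfl | rfl
  · exact ⟨true, by simp [sgn]⟩
  · exact ⟨false, by simp [sgn]⟩

/-- **The critical points of `g` of index `i` on the thin tubes.** [cite: GayKirby2016, §4, Lemma 14] -/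
def circleCrit (i : ℕ) : Set B.Y := {y | y ∈ criticalSetOfIndex (𝓡 3) B.g i ∧ ∃ j, y ∈ 𝔉.tubeNbhd j}

/-- The axis points of the axis `e_k`, parametrised by the circle and the sign. [folklore] -/
def axisFamily {k : Fin 4} (hk : k = 0 ∨ k = 1) (jb : ι × Bool) : B.Y :=
  𝔉.axisPt jb.1 hk (sgn_cases jb.2)

omit [T2Space X] [CompactSpace X] in
/-- The parametrisation of the axis points is injective (distinct tubes are disjoint; on one
tube the coordinates differ). [folklore] -/
theorem axisFamily_injective {k : Fin 4} (hk : k = 0 ∨ k = 1) : Injective (𝔉.axisFamily hk) := by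
  rintro ⟨j, b⟩ ⟨j', b'⟩ h
  have hj : j = j' := by
    by_contra hjj
    have h1 : 𝔉.axisFamily hk (j, b) ∈ 𝔉.tubeNbhd j := 𝔉.axisPt_mem_tubeNbhd hk _
    have h2 : 𝔉.axisFamily hk (j', b') ∈ 𝔉.tubeNbhd j' := 𝔉.axisPt_mem_tubeNbhd hk _
    rw [h] at h1
    exact Set.disjoint_left.1 (𝔉.tubeNbhd_disjoint hjj) h1 h2
  subst hj
  have hc := 𝔉.chart_axisPt_sub (j := j) hk (sgn_cases b)
  have hc' := 𝔉.chart_axisPt_sub (j := j) hk (sgn_cases b')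
  have hv : 𝔉.axisVec k (sgn b) = 𝔉.axisVec k (sgn b') := by
    rw [← hc, ← hc']
    show (𝔉.boxes.box j).chart (𝔉.axisFamily hk (j, b)).1 - _ = (𝔉.boxes.box j).chart (𝔉.axisFamily hk (j, b')).1 - _
    rw [h]
  have hk' := congrArg (fun v : EuclideanSpace ℝ (Fin 4) => v k) hv
  simp only [axisVec_apply, ↓reduceIte] at hk'
  have hr : Real.sqrt 𝔉.η₂ ≠ 0 := (Real.sqrt_pos.2 𝔉.η₂_pos).ne'
  have hs : sgn b = sgn b' := mul_right_cancel₀ hr hk'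
  have hbb : b = b' := by
    revert hs; cases b <;> cases b' <;> simp [sgn] <;> norm_num
  rw [hbb]

omit [T2Space X] [CompactSpace X] in
/-- **The circle critical points of index `0` are the axis points of the axes `e₀`, those of
index `1` the axis points of the axes `e₁`.** [cite: GayKirby2016, §4, Lemma 14] -/
theorem circleCrit_eq_range (hεT : 0 < 𝔉.εT) {k : Fin 4} (hk : k = 0 ∨ k = 1) :
    𝔉.circleCrit (if k = 0 then 0 else 1) = range (𝔉.axisFamily hk) := by
  ext y
  constructor
  · rintro ⟨⟨hc, hidx⟩, j, hj⟩
    obtain ⟨k', hk', s, hs, rfl⟩ := (𝔉.isMCriticalPt_g_iff_eq_axisPt hεT hj).1 hc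
    have hidx' := (𝔉.nondegenerate_and_morseIndex_g_axisPt (j := j) hεT hk' hs).2
    rw [hidx'] at hidx
    have hkk : k' = k := by
      rcases hk with rfl | rfl <;> rcases hk' with rfl | rfl <;> simp at hidx ⊢
    subst hkk
    obtain ⟨b, rfl⟩ := exists_sgn_eq hs
    exact ⟨(j, b), rfl⟩
  · rintro ⟨⟨j, b⟩, rfl⟩
    refine ⟨⟨(𝔉.isMCriticalPt_g_iff_eq_axisPt hεT (𝔉.axisPt_mem_tubeNbhd hk _)).2 ⟨k, hk, _, _, rfl⟩, ?_⟩,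
      j, 𝔉.axisPt_mem_tubeNbhd hk _⟩
    exact (𝔉.nondegenerate_and_morseIndex_g_axisPt hεT hk _).2

omit [T2Space X] [CompactSpace X] in
/-- The number of axis points of one family is `2m`. [folklore] -/
theorem ncard_range_axisFamily {k : Fin 4} (hk : k = 0 ∨ k = 1) :
    (range (𝔉.axisFamily hk)).ncard = 2 * Fintype.card ι := by
  rw [← image_univ, (𝔉.axisFamily_injective hk).injOn.ncard_image, ncard_univ, Nat.card_prod,
    Nat.card_eq_fintype_card, Nat.card_eq_fintype_card, Fintype.card_bool]
  ring

omit [T2Space X] [CompactSpace X] in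
/-- **`2m` circle critical points of index `0`, `2m` of index `1`.** [cite: GayKirby2016, §4, Lemma 14] -/
theorem ncard_circleCrit (hεT : 0 < 𝔉.εT) {i : ℕ} (hi : i = 0 ∨ i = 1) :
    (𝔉.circleCrit i).ncard = 2 * Fintype.card ι := by
  rcases hi with rfl | rfl
  · have h := 𝔉.circleCrit_eq_range hεT (k := 0) (Or.inl rfl)
    rw [if_pos rfl] at h
    rw [h, 𝔉.ncard_range_axisFamily]
  · have h := 𝔉.circleCrit_eq_range hεT (k := 1) (Or.inr rfl)
    rw [if_neg (by decide)] at h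
    rw [h, 𝔉.ncard_range_axisFamily]

omit [T2Space X] [CompactSpace X] in
/-- No circle critical point has index `≥ 2`. [cite: GayKirby2016, §4, Lemma 14] -/
theorem circleCrit_eq_empty (hεT : 0 < 𝔉.εT) {i : ℕ} (hi : 2 ≤ i) : 𝔉.circleCrit i = ∅ := by
  refine Set.eq_empty_of_forall_notMem fun y hy => ?_
  obtain ⟨⟨hc, hidx⟩, j, hj⟩ := hy
  obtain ⟨k, hk, s, hs, rfl⟩ := (𝔉.isMCriticalPt_g_iff_eq_axisPt hεT hj).1 hc
  rw [(𝔉.nondegenerate_and_morseIndex_g_axisPt (j := j) hεT hk hs).2] at hidx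
  split_ifs at hidx <;> omega

omit [T2Space X] [CompactSpace X] in
/-- A circle critical point is an axis point, where `g ≤ b - m₀/2 < b`. [folklore] -/
theorem g_lt_b_of_mem_circleCrit (𝔓 : 𝔉.BeltParams) (hεT : 0 < 𝔉.εT) {i : ℕ} {y : B.Y} (hy : y ∈ 𝔉.circleCrit i) :
    B.g y < B.b := by
  obtain ⟨⟨hc, -⟩, j, hj⟩ := hy
  obtain ⟨k, hk, s, hs, rfl⟩ := (𝔉.isMCriticalPt_g_iff_eq_axisPt hεT hj).1 hc
  have h := 𝔉.g_axisPt_le (j := j) 𝔓 hk hs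
  have hm : 0 < 𝔉.m₀ := by linarith [𝔉.lt_m₀, T.ε_pos]
  linarith

namespace BeltParams

variable {𝔉} (𝔓 : 𝔉.BeltParams) (hc2 : B.a + B.U.δ + 2 * T.ε ≤ T.c)

omit [T2Space X] [CompactSpace X] in
include 𝔓 in
/-- **The critical points of `g` of index `i` below `b`, split by the thin tubes**:
`Crit_i(g) ∩ {g < b} = critY_i ⊔ circleCrit_i`. [cite: GayKirby2016, §4, Lemma 14] -/
theorem crit_g_eq_union (hεT : 0 < 𝔉.εT) (i : ℕ) :
    criticalSetOfIndex (𝓡 3) B.g i ∩ B.g ⁻¹' Iio B.b = 𝔉.critY i ∪ 𝔉.circleCrit i := by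
  ext y
  constructor
  · rintro ⟨hc, hb⟩
    by_cases ht : ∃ j, y ∈ 𝔉.tubeNbhd j
    · exact Or.inr ⟨hc, ht⟩
    · push Not at ht
      exact Or.inl ⟨hc, hb, ht⟩
  · rintro (⟨hc, hb, -⟩ | hy)
    · exact ⟨hc, hb⟩
    · exact ⟨hy.1, 𝔉.g_lt_b_of_mem_circleCrit 𝔓 hεT hy⟩

omit [T2Space X] in
include 𝔓 in
/-- **`c_i(g) = #critY_i + 2m` for `i = 0, 1`** (`c_i(g)` the number of critical points of the
Morse function `g` of index `i` below `b`). [cite: GayKirby2016, §4, Lemma 14] -/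
theorem ncard_crit_g_eq (hgM : IsMorse (𝓡 3) B.g) (hεT : 0 < 𝔉.εT) {i : ℕ} (hi : i = 0 ∨ i = 1) :
    (criticalSetOfIndex (𝓡 3) B.g i ∩ B.g ⁻¹' Iio B.b).ncard = (𝔉.critY i).ncard + 2 * Fintype.card ι := by
  have hfin : (criticalSet (𝓡 3) B.g).Finite := IsMorse.finite_criticalSet_holds hgM
  have h1 : (𝔉.critY i).Finite := hfin.subset fun y hy => hy.1.1
  have h2 : (𝔉.circleCrit i).Finite := hfin.subset fun y hy => hy.1.1
  have hdisj : Disjoint (𝔉.critY i) (𝔉.circleCrit i) :=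
    Set.disjoint_left.2 fun y hy hy' => by obtain ⟨j, hj⟩ := hy'.2; exact hy.2.2 j hj
  rw [𝔓.crit_g_eq_union hεT i, ncard_union_eq hdisj h1 h2, 𝔉.ncard_circleCrit hεT hi]

/-! ### `F_H` is a Morse function adapted to the boundary; its critical points -/

/-- **Every critical point of `F_H` is nondegenerate, of index `≤ 1`**, provided `g` is a Morse
function whose critical points below `b` have index `≤ 1` (a critical point is off the box; in
a zone it is a belt point of index `0` or `1`, elsewhere a lid point of index that of `g` at the
landing point). [cite: GayKirby2016, §4, Lemma 14] -/
theorem nondegenerate_and_morseIndex_FH_le_one (hgM : IsMorse (𝓡 3) B.g)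
    (hidx : ∀ y, IsMCriticalPt (𝓡 3) B.g y → B.g y < B.b → morseIndex (𝓡 3) B.g y ≤ 1) {p : T.H₂₃}
    (hp : letI := (T.bsliceAtlas hc2 𝔉.two_mul_ε_le 𝔉.linkCondition).chartedSpace
      IsMCriticalPt (𝓡∂ 3) 𝔓.FH p) :
    letI := (T.bsliceAtlas hc2 𝔉.two_mul_ε_le 𝔉.linkCondition).chartedSpace
    (mhessian (𝓡∂ 3) 𝔓.FH p).Nondegenerate ∧ morseIndex (𝓡∂ 3) 𝔓.FH p ≤ 1 := by
  letI := (T.bsliceAtlas hc2 𝔉.two_mul_ε_le 𝔉.linkCondition).chartedSpace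
  have hb : p.1 ∉ B.box T.D.εw := fun hb => 𝔓.not_isMCriticalPt_FH_of_mem_box hc2 hb hp
  by_cases hz : ∃ j, p.1 ∈ 𝔓.zone j
  · obtain ⟨j, hj⟩ := hz
    obtain ⟨hnd, hidx'⟩ := 𝔓.nondegenerate_and_morseIndex_FH_of_mem_zone hc2 hj hp
    refine ⟨hnd, ?_⟩
    rw [hidx']; split_ifs <;> omega
  · push Not at hz
    obtain ⟨hps, hp₁, hh⟩ := 𝔓.hit_of_not_mem_box hc2 hb hz
    obtain ⟨hnd, hidx'⟩ := 𝔓.nondegenerate_and_morseIndex_FH_eq_of_hit hc2 hgM hps hh hz hp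
    obtain ⟨hcg, -⟩ := 𝔓.isMCriticalPt_g_of_isMCriticalPt_FH hc2 hps hh hz hp
    obtain ⟨hfc, hwε⟩ := 𝔓.f_eq_c_of_isMCriticalPt_FH hc2 hps hh hz hp
    refine ⟨hnd, ?_⟩
    rw [hidx']
    apply hidx _ hcg
    have h0 : T.M p.1 = 0 := T.M_eq_zero_of_mem_H₂₃ p.2 hh
    have hM : T.M p.1 = B.gFun p.1 + creaseσ T.ε (T.w p.1) := rfl
    rw [creaseσ_of_le T.ε_pos hwε] at hM
    have hG : B.gFun p.1 = B.g (B.lamLift p.1) - B.b := rfl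
    linarith [T.ε_pos]

/-- **`F_H` is a Morse function adapted to the boundary of `H₂₃`** (`= 1` and regular on the
boundary — the central surface —, `< 1` inside, nondegenerate critical points). [cite: GayKirby2016, §4, Lemma 14] [cite: Milnor1963, §3] -/
theorem isMorseAdapted_FH (hgM : IsMorse (𝓡 3) B.g)
    (hidx : ∀ y, IsMCriticalPt (𝓡 3) B.g y → B.g y < B.b → morseIndex (𝓡 3) B.g y ≤ 1) :
    letI := (T.bsliceAtlas hc2 𝔉.two_mul_ε_le 𝔉.linkCondition).chartedSpace
    IsMorseAdapted (𝓡∂ 3) 𝔓.FH := by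
  letI := (T.bsliceAtlas hc2 𝔉.two_mul_ε_le 𝔉.linkCondition).chartedSpace
  refine ⟨⟨𝔓.contMDiff_FH hc2, fun p hp => (𝔓.nondegenerate_and_morseIndex_FH_le_one hc2 hgM hidx hp).1⟩,
    fun p hp => ?_, fun p hp => ?_⟩
  · have hps : p.1 ∈ B.surface := (T.isBoundaryPoint_iff_mem_surface hc2 𝔉.two_mul_ε_le 𝔉.linkCondition p).1 hp
    exact ⟨𝔓.FH_eq_one_of_mem_surface hps,
      𝔓.not_isMCriticalPt_FH_of_mem_box hc2 (B.mem_box_of_mem_surface T.D.εw_pos hps)⟩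
  · have hps : p.1 ∉ B.surface := fun hs => by
      have hbd := (T.isBoundaryPoint_iff_mem_surface hc2 𝔉.two_mul_ε_le 𝔉.linkCondition p).2 hs
      exact (ModelWithCorners.isInteriorPoint_iff_not_isBoundaryPoint p).1 hp hbd
    exact 𝔓.FH_lt_one_of_not_mem_surface hc2 hps

/-- **The belt part of the critical set of `F_H` of index `i`**: the critical points of index `i`
in the core zones. [cite: GayKirby2016, §4, Lemma 14] -/
def beltCrit (i : ℕ) : Set T.H₂₃ :=
  {p | (∃ j, p.1 ∈ 𝔓.zone j) ∧
    letI := (T.bsliceAtlas hc2 𝔉.two_mul_ε_le 𝔉.linkCondition).chartedSpace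
    p ∈ criticalSetOfIndex (𝓡∂ 3) 𝔓.FH i}

/-- **The critical set of `F_H` of index `i` is the disjoint union of its lid part and its belt
part** (no critical point lies in the bi-collar box). [cite: GayKirby2016, §4, Lemma 14] -/
theorem criticalSetOfIndex_FH_eq (i : ℕ) :
    letI := (T.bsliceAtlas hc2 𝔉.two_mul_ε_le 𝔉.linkCondition).chartedSpace
    criticalSetOfIndex (𝓡∂ 3) 𝔓.FH i = 𝔓.lidCrit hc2 i ∪ 𝔓.beltCrit hc2 i := by
  letI := (T.bsliceAtlas hc2 𝔉.two_mul_ε_le 𝔉.linkCondition).chartedSpace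
  ext p
  constructor
  · intro hp
    have hb : p.1 ∉ B.box T.D.εw := fun hb => 𝔓.not_isMCriticalPt_FH_of_mem_box hc2 hb hp.1
    by_cases hz : ∃ j, p.1 ∈ 𝔓.zone j
    · exact Or.inr ⟨hz, hp⟩
    · push Not at hz
      exact Or.inl ⟨hb, hz, hp⟩
  · rintro (⟨-, -, hp⟩ | ⟨-, hp⟩)
    · exact hp
    · exact hp

/-- The belt point `q_j(s)` as a point of `H₂₃` (`s = ±ν`). [folklore] -/
def beltPtH (s : ℝ) (hs : s ^ 2 = 𝔉.ν ^ 2) (j : ι) : T.H₂₃ := ⟨𝔉.beltPt j s, 𝔓.beltPt_mem_H₂₃ hc2 hs⟩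

omit [T2Space X] [CompactSpace X] in
include 𝔓 in
/-- The belt points of distinct zones are distinct (each lies in its zone). [folklore] -/
theorem beltPt_injective {s : ℝ} (hs : s ^ 2 = 𝔉.ν ^ 2) : Injective fun j => 𝔉.beltPt j s := by
  intro j j' h
  by_contra hjj
  have h1 : 𝔉.beltPt j s ∈ 𝔓.zone j := 𝔓.beltPt_mem_zone hs
  have h2 : 𝔉.beltPt j' s ∈ 𝔓.zone j' := 𝔓.beltPt_mem_zone hs
  have h' : 𝔉.beltPt j s = 𝔉.beltPt j' s := h
  rw [h'] at h1
  exact Set.disjoint_left.1 (𝔓.zone_disjoint hjj) h1 h2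

/-- **The belt critical points of index `0` are the `q_j(ν)`, those of index `1` the `q_j(-ν)`.** [cite: GayKirby2016, §4, Lemma 14] -/
theorem beltCrit_eq_range {s : ℝ} (hs : s = 𝔉.ν ∨ s = -𝔉.ν) :
    𝔓.beltCrit hc2 (if s = 𝔉.ν then 0 else 1) =
      range (𝔓.beltPtH hc2 s (by rcases hs with rfl | rfl <;> ring)) := by
  letI := (T.bsliceAtlas hc2 𝔉.two_mul_ε_le 𝔉.linkCondition).chartedSpace
  have hν := 𝔉.ν_pos
  ext p
  constructor
  · rintro ⟨⟨j, hj⟩, hc, hidx⟩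
    rcases (𝔓.isMCriticalPt_FH_iff_eq_beltPt hc2 hj).1 hc with h | h
    · obtain ⟨-, -, hidx'⟩ := 𝔓.morseIndex_FH_beltPt hc2 (Or.inl rfl) p h
      rw [hidx', if_pos rfl] at hidx
      have hsν : s = 𝔉.ν := by
        rcases hs with h' | h'
        · exact h'
        · exfalso; rw [h', if_neg (by linarith)] at hidx; exact absurd hidx (by norm_num)
      subst hsν
      exact ⟨j, Subtype.ext h.symm⟩
    · obtain ⟨-, -, hidx'⟩ := 𝔓.morseIndex_FH_beltPt hc2 (Or.inr rfl) p h
      rw [hidx', if_neg (by linarith)] at hidx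
      have hsν : s = -𝔉.ν := by
        rcases hs with h' | h'
        · exfalso; rw [h', if_pos rfl] at hidx; exact absurd hidx (by norm_num)
        · exact h'
      subst hsν
      exact ⟨j, Subtype.ext h.symm⟩
  · rintro ⟨j, rfl⟩
    have hs2 : s ^ 2 = 𝔉.ν ^ 2 := by rcases hs with rfl | rfl <;> ring
    obtain ⟨hc, -, hidx⟩ := 𝔓.morseIndex_FH_beltPt hc2 hs (𝔓.beltPtH hc2 s hs2 j) rfl
    exact ⟨⟨j, 𝔓.beltPt_mem_zone hs2⟩, hc, hidx⟩

/-- **`m` belt critical points of index `0`, `m` of index `1`.** [cite: GayKirby2016, §4, Lemma 14] -/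
theorem ncard_beltCrit {i : ℕ} (hi : i = 0 ∨ i = 1) : (𝔓.beltCrit hc2 i).ncard = Fintype.card ι := by
  have hν := 𝔉.ν_pos
  have key : ∀ {s : ℝ} (hs : s = 𝔉.ν ∨ s = -𝔉.ν),
      (𝔓.beltCrit hc2 (if s = 𝔉.ν then 0 else 1)).ncard = Fintype.card ι := by
    intro s hs
    have hs2 : s ^ 2 = 𝔉.ν ^ 2 := by rcases hs with rfl | rfl <;> ring
    have hinj : Injective (𝔓.beltPtH hc2 s hs2) := fun j j' h =>
      𝔓.beltPt_injective hs2 (congrArg Subtype.val h)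
    rw [𝔓.beltCrit_eq_range hc2 hs, ← image_univ, hinj.injOn.ncard_image, ncard_univ, Nat.card_eq_fintype_card]
  rcases hi with rfl | rfl
  · have h := key (Or.inl rfl); rwa [if_pos rfl] at h
  · have h := key (Or.inr rfl); rwa [if_neg (by linarith)] at h

/-- No belt critical point has index `≥ 2`. [cite: GayKirby2016, §4, Lemma 14] -/
theorem beltCrit_eq_empty {i : ℕ} (hi : 2 ≤ i) : 𝔓.beltCrit hc2 i = ∅ := by
  letI := (T.bsliceAtlas hc2 𝔉.two_mul_ε_le 𝔉.linkCondition).chartedSpace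
  refine Set.eq_empty_of_forall_notMem fun p hp => ?_
  obtain ⟨⟨j, hj⟩, hc, hidx⟩ := hp
  rw [(𝔓.nondegenerate_and_morseIndex_FH_of_mem_zone hc2 hj hc).2] at hidx
  split_ifs at hidx <;> omega

/-- No lid critical point has index `≥ 2` (the index is that of `g` at the landing point, `≤ 1`
below `b`). [cite: GayKirby2016, §4, Lemma 14] -/
theorem lidCrit_eq_empty (hgM : IsMorse (𝓡 3) B.g) (hεT : 0 < 𝔉.εT)
    (hidx : ∀ y, IsMCriticalPt (𝓡 3) B.g y → B.g y < B.b → morseIndex (𝓡 3) B.g y ≤ 1) {i : ℕ} (hi : 2 ≤ i) :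
    𝔓.lidCrit hc2 i = ∅ := by
  refine Set.eq_empty_of_forall_notMem fun p hp => ?_
  obtain ⟨⟨hc, hidx'⟩, hgb, -⟩ := (𝔉.mem_critY).1 (𝔓.lamLift_mem_critY hc2 hgM hεT hp)
  have := hidx _ hc hgb
  omega

/-- **The number of critical points of `F_H` of index `i`**: `#critY_i + m` for `i = 0, 1`. [cite: GayKirby2016, §4, Lemma 14] -/
theorem ncard_criticalSetOfIndex_FH (hgM : IsMorse (𝓡 3) B.g) (hεT : 0 < 𝔉.εT)
    (hidx : ∀ y, IsMCriticalPt (𝓡 3) B.g y → B.g y < B.b → morseIndex (𝓡 3) B.g y ≤ 1) {i : ℕ} (hi : i = 0 ∨ i = 1) :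
    letI := (T.bsliceAtlas hc2 𝔉.two_mul_ε_le 𝔉.linkCondition).chartedSpace
    (criticalSetOfIndex (𝓡∂ 3) 𝔓.FH i).ncard = (𝔉.critY i).ncard + Fintype.card ι := by
  letI := (T.bsliceAtlas hc2 𝔉.two_mul_ε_le 𝔉.linkCondition).chartedSpace
  haveI := (T.bsliceAtlas hc2 𝔉.two_mul_ε_le 𝔉.linkCondition).isManifold
  haveI : CompactSpace T.H₂₃ := T.compactSpace_H₂₃
  have hfin : (criticalSet (𝓡∂ 3) 𝔓.FH).Finite :=
    IsMorse.finite_criticalSet_holds (𝔓.isMorseAdapted_FH hc2 hgM hidx).isMorse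
  have h1 : (𝔓.lidCrit hc2 i).Finite := hfin.subset fun p hp => hp.2.2.1
  have h2 : (𝔓.beltCrit hc2 i).Finite := hfin.subset fun p hp => hp.2.1
  have hdisj : Disjoint (𝔓.lidCrit hc2 i) (𝔓.beltCrit hc2 i) :=
    Set.disjoint_left.2 fun p hp hp' => by obtain ⟨j, hj⟩ := hp'.1; exact hp.2.1 j hj
  rw [𝔓.criticalSetOfIndex_FH_eq hc2 i, ncard_union_eq hdisj h1 h2, 𝔓.ncard_lidCrit_eq hc2 hgM hεT,
    𝔓.ncard_beltCrit hc2 hi]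

/-- `F_H` has no critical point of index `≥ 2`. [cite: GayKirby2016, §4, Lemma 14] -/
theorem ncard_criticalSetOfIndex_FH_of_two_le (hgM : IsMorse (𝓡 3) B.g) (hεT : 0 < 𝔉.εT)
    (hidx : ∀ y, IsMCriticalPt (𝓡 3) B.g y → B.g y < B.b → morseIndex (𝓡 3) B.g y ≤ 1) {i : ℕ} (hi : 2 ≤ i) :
    letI := (T.bsliceAtlas hc2 𝔉.two_mul_ε_le 𝔉.linkCondition).chartedSpace
    (criticalSetOfIndex (𝓡∂ 3) 𝔓.FH i).ncard = 0 := by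
  rw [𝔓.criticalSetOfIndex_FH_eq hc2 i, 𝔓.lidCrit_eq_empty hc2 hgM hεT hidx hi, 𝔓.beltCrit_eq_empty hc2 hi,
    empty_union, ncard_empty]

/-! ### Connectedness of `H₂₃` -/

include 𝔓 hc2 in
/-- **`H₂₃` is connected** when the central surface is: a closed-open part of `H₂₃` missing the
boundary would carry a maximum of `F_H` at an interior point, a critical point of index
`3 = dim` (turning `F_H` about, `IsMorse.morseIndex_const_sub_add`), whereas all critical points
of `F_H` have index `≤ 1`. [cite: GayKirby2016, §4, Lemma 14] [cite: MilnorHCobordism1965, proof of Thm. 9.1] -/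
theorem connectedSpace_H₂₃ (hgM : IsMorse (𝓡 3) B.g)
    (hidx : ∀ y, IsMCriticalPt (𝓡 3) B.g y → B.g y < B.b → morseIndex (𝓡 3) B.g y ≤ 1)
    (hsurf : IsConnected B.surface) : ConnectedSpace T.H₂₃ := by
  letI := (T.bsliceAtlas hc2 𝔉.two_mul_ε_le 𝔉.linkCondition).chartedSpace
  haveI := (T.bsliceAtlas hc2 𝔉.two_mul_ε_le 𝔉.linkCondition).isManifold
  haveI : CompactSpace T.H₂₃ := T.compactSpace_H₂₃
  have hMorse := (𝔓.isMorseAdapted_FH hc2 hgM hidx).isMorse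
  rw [connectedSpace_iff_clopen]
  obtain ⟨z₀, hz₀⟩ := hsurf.nonempty
  refine ⟨⟨⟨z₀, T.surface_subset_H₂₃ hz₀⟩⟩, fun U hU => ?_⟩
  by_contra hne
  push Not at hne
  -- the surface, seen in `H₂₃`, is preconnected
  set S : Set T.H₂₃ := (Subtype.val : T.H₂₃ → X) ⁻¹' B.surface with hSdef
  have hSconn : IsPreconnected S := by
    haveI : ConnectedSpace B.surface := isConnected_iff_connectedSpace.1 hsurf
    have hφ : Continuous fun z : B.surface => (⟨z.1, T.surface_subset_H₂₃ z.2⟩ : T.H₂₃) :=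
      continuous_subtype_val.subtype_mk _
    have hrange : range (fun z : B.surface => (⟨z.1, T.surface_subset_H₂₃ z.2⟩ : T.H₂₃)) = S := by
      ext p
      constructor
      · rintro ⟨z, rfl⟩; exact z.2
      · intro hp; exact ⟨⟨p.1, hp⟩, rfl⟩
    rw [← hrange]
    exact (isConnected_range hφ).isPreconnected
  -- a clopen nonempty part `V` missing the surface
  obtain ⟨V, hV, hVne, hSV⟩ : ∃ V : Set T.H₂₃, IsClopen V ∧ V.Nonempty ∧ ∀ p ∈ V, p.1 ∉ B.surface := by
    by_cases h : (S ∩ U).Nonempty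
    · have hSU : S ⊆ U := hSconn.subset_isClopen hU h
      refine ⟨Uᶜ, hU.compl, ?_, fun p hp hps => hp (hSU hps)⟩
      rw [nonempty_compl]; exact hne.2
    · refine ⟨U, hU, hne.1, fun p hp hps => h ⟨p, hps, hp⟩⟩
  -- the maximum of `F_H` on `V` is an interior critical point of index `3`
  have hcont : Continuous 𝔓.FH := (𝔓.contMDiff_FH hc2).continuous
  obtain ⟨x, hxV, hmax⟩ := hV.isClosed.isCompact.exists_isMaxOn hVne hcont.continuousOn
  have hloc : IsLocalMax 𝔓.FH x := hmax.isLocalMax (hV.isOpen.mem_nhds hxV)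
  have hint : (𝓡∂ 3).IsInteriorPoint x := by
    rw [ModelWithCorners.isInteriorPoint_iff_not_isBoundaryPoint,
      T.isBoundaryPoint_iff_mem_surface hc2 𝔉.two_mul_ε_le 𝔉.linkCondition x]
    exact (hSV x hxV)
  have hcrit : IsMCriticalPt (𝓡∂ 3) 𝔓.FH x := isMCriticalPt_of_isLocalMax hloc hint
  have hmin : IsLocalMin (fun y => 0 - 𝔓.FH y) x := by
    have h' := hloc.neg
    simp only [zero_sub]
    exact h'
  have h0 : morseIndex (𝓡∂ 3) (fun y => 0 - 𝔓.FH y) x = 0 :=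
    morseIndex_eq_zero_of_isLocalMin_of_isInteriorPoint
      ((contMDiffAt_const.sub ((𝔓.contMDiff_FH hc2) x)).of_le (by norm_cast)) hmin hint
  have hadd := hMorse.morseIndex_const_sub_add 0 hcrit
  rw [h0, finrank_euclideanSpace_fin] at hadd
  have hle := (𝔓.nondegenerate_and_morseIndex_FH_le_one hc2 hgM hidx hcrit).2
  omega

/-! ### The handle decomposition of `H₂₃` -/

include 𝔓 in
/-- **`H₂₃` has a handle decomposition with one `0`-handle and `gen` `1`-handles,
`gen + c₀(g) = c₁(g) + 1`** — the hypothesis `hH₂₃` of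
`BiCollar.exists_isBalancedGKTrisection_of_handles` (Gay–Kirby: "`H₂₃` is a genus `g`
handlebody").  Here `c_i(g)` is the number of critical points of index `i` below `b` of the
Morse function `g` of the Heegaard splitting, whose critical points below `b` have index `≤ 1`,
and the central surface is assumed connected; the genus is pinned by the same relation as that
of `H₁₂ = {g ≤ b}` (`RegularSublevel.hasHandleDecomposition_handleCount_one`).  The adapted Morse
function is `F_H` (`TrisectionsH23Function.lean`), with `#critY_i + m` critical points of index
`i = 0, 1` and none of higher index, and `c_i(g) = #critY_i + 2m`; the surplus `0`-handles
cancel (Milnor 1965, Thm. 8.1, `hasHandleDecomposition_handleCount_one_of_two_le`).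
[cite: GayKirby2016, §4, Lemma 14] [cite: MilnorHCobordism1965, Thm. 8.1] -/
theorem hasHandleDecomposition_H₂₃ [SecondCountableTopology X] (hgM : IsMorse (𝓡 3) B.g) (hεT : 0 < 𝔉.εT)
    (hidx : ∀ y, IsMCriticalPt (𝓡 3) B.g y → B.g y < B.b → morseIndex (𝓡 3) B.g y ≤ 1)
    (hsurf : IsConnected B.surface) {gen : ℕ}
    (hgen : gen + (criticalSetOfIndex (𝓡 3) B.g 0 ∩ B.g ⁻¹' Iio B.b).ncard =
      (criticalSetOfIndex (𝓡 3) B.g 1 ∩ B.g ⁻¹' Iio B.b).ncard + 1) :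
    letI := (T.bsliceAtlas hc2 𝔉.two_mul_ε_le 𝔉.linkCondition).chartedSpace
    HasHandleDecomposition 2 T.H₂₃ (handleCount 1 gen) := by
  letI := (T.bsliceAtlas hc2 𝔉.two_mul_ε_le 𝔉.linkCondition).chartedSpace
  haveI := (T.bsliceAtlas hc2 𝔉.two_mul_ε_le 𝔉.linkCondition).isManifold
  haveI : CompactSpace T.H₂₃ := T.compactSpace_H₂₃
  haveI : ConnectedSpace T.H₂₃ := 𝔓.connectedSpace_H₂₃ hc2 hgM hidx hsurf
  obtain ⟨z₀, hz₀⟩ := hsurf.nonempty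
  haveI : Nonempty T.H₂₃ := ⟨⟨z₀, T.surface_subset_H₂₃ hz₀⟩⟩
  have h : HasHandleDecomposition 2 T.H₂₃ fun i => (criticalSetOfIndex (𝓡∂ 3) 𝔓.FH i).ncard :=
    ⟨𝔓.FH, 𝔓.isMorseAdapted_FH hc2 hgM hidx, fun _ => rfl⟩
  refine hasHandleDecomposition_handleCount_one_of_two_le h
    (fun k hk => 𝔓.ncard_criticalSetOfIndex_FH_of_two_le hc2 hgM hεT hidx hk) ?_
  show gen + (criticalSetOfIndex (𝓡∂ 3) 𝔓.FH 0).ncard = (criticalSetOfIndex (𝓡∂ 3) 𝔓.FH 1).ncard + 1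
  rw [𝔓.ncard_criticalSetOfIndex_FH hc2 hgM hεT hidx (Or.inl rfl),
    𝔓.ncard_criticalSetOfIndex_FH hc2 hgM hεT hidx (Or.inr rfl)]
  have h0 := 𝔓.ncard_crit_g_eq hgM hεT (i := 0) (Or.inl rfl)
  have h1 := 𝔓.ncard_crit_g_eq hgM hεT (i := 1) (Or.inr rfl)
  omega

end BeltParams

end TubeFrame

end TriData

end BiCollar

end Literature.Topology.FourManifolds

end
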